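/-
Origin: expansion seat `prover-pub-hodgecm-mc-binder-2-g19-0`, handover #102 2026-08-21T01:00Z md5 8a97ae7c5fa6 (NEW; 262 l.; ns HodgeCM.Model + HodgeCM.Model.SplitLineE; THE PIN's V-SIDE CONSTANTS AT E (consensus theta-3-g28 l.14859 ∕ axioms-1-g16 l.14870 ∕ sinst-1-g10 l.14875 ∕ model1-g17 l.14882: no constant differs, home under binder-2 tag): §1 reducible abbrev TERMS **SplitLineE V** := SplitLine (Matrix.diagonal (frameD V)) (realDiagonal L (frameD V) (frameD_real V)) (complexConj_imagUnit L) (imagUnit_ne_zero L) (imagUnit_mul_self L) (realDiagonal_isSymm …) (isUnit_det_realDiagonal … (frameD_ne V)) (realDiagonal_map …).symm (= the splittingDatum constants of the vendored cmSplittingDatum L e (frameD V) … — sinst-1's splitLineZero∕One are terms of it on the nose), **ιVE V** := finFrameCongr L V.Hm (frameG V) (frameD V) (frame_congr V) + continuous_ιVE, §1b **SplitLineE.ofCM V e dW hdW hdW0 s hs** ∕ **SplitLineE.ofCMOf … hGR** (the index line of record over a diagonal Gram scalar family dW : Fin 1 → L — W-fields LITERALLY the cmSplittingDatum constants so hs ∕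 splittingOf_isCompatible are accepted with no transport; ofCM_scalar : scalar = dW 0, ofCM_lineType, ofCMOf_scalar, continuous_pairSplitting_ofCMOf), **liuDictionaryPin … V I line := liuDictionaryOfWeilFamilyAut … V (ιVE V) I line** (line : I → SplitLineE V; _eq rfl) = THE PINNED DICTIONARY modulo the theta lane's (I V, line V) (theta-3's Model∕LiuIndexPin.lean, RUN 69+); §2 sockets at the pin: hsmall_of_pin_at_of_isometric ∕ hsmall_of_pin_at_of_lineType_eq (#100), mem_biSup_block_pin_of_mem_iSup_range (#101), exists_isometric_of_scalar_eq (slot clause from scalar equality, z := 1); §3 K0 at the pin: Ω_smooth_pin (#99, Continuous ιV DISCHARGED by continuous_finFrameCongr), isLevelTrivial_of_irreducible_pin, nontrivial_Ω_of_irreducible_pin, line_injective_of_muSeparated_pin. CERT lane farm lean-direct over g19∕farm∕mirror = PKG RUN-67 oleans + binder-2 #99–#101 oleans compiled from the RUN-68 kit sources (= installed bodies, INSTALLED-CHECK₆₈ f9a65737bafe): rc 0 ∕ 94 s ∕ 0 warn ∕ 0 proof holes; #print axioms 14 ∕ 14 ⊆ {propext, Classical.choice, Quot.sound}, proof-holeAx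 0 (g19∕farm∕logs∕ax_pin.log 74ad028761b8); FQN 0 ∕ 19 vs headline-decls a933f2359af0 + PKG + other lanes' stage68∕69 (sinst-1 #1254 names disjoint); the draft «ATp» (g19∕drafts-not-staged, 5eba3a101d9b) compiles over it (rc 0). NAME LIST (theorems): HodgeCM.Model.hsmall_of_pin_at_of_isometric · HodgeCM.Model.SplitLineE.continuous_pairSplitting_ofCMOf · HodgeCM.Model.Ω_smooth_pin. (`HOME/mc/pub-hodgecm-mc-binder-2/g19/stage69/HodgeCM/Model/LiuDictionaryPin.lean`, md5 8a97ae7c5fa6, 262 lines);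
landed by the gen-29 packager (p-g29) in gate run 69 as `HodgeCM/Model/LiuDictionaryPin.lean` (verbatim).
-/
/-
Origin: BINDER seat `prover-pub-hodgecm-mc-binder-2-g19-0` (unit pub-hodgecm-mc-binder-2-g19, gen 19 of mc-binder-2), 2026-08-21.
Target in PKG: `HodgeCM/Model/LiuDictionaryPin.lean` (NEW additive KERNEL leaf beside E; imports binder-2 #99 `Model/Binders/JLiuK0Smooth`,
#100 `Model/HsmallOfTowerAtLineTypeEq`, #101 `Model/Binders/JLiuBlockTransport` (RUN 68) + INSTALLED `Model/ArchKTypeOfFin` (carch, `finFrameCongr`)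
+ `Model/WmInstanceV2` (unitary-1, `frameD`/`frameG`/`frame_congr`); nothing imports it; outside E's import closure; E
`Model/E2InstanceOGR21AEPI.lean` 4c667377ea4b untouched; MODEL-N ±0).
KERNEL ONLY: 3 reducible abbreviations (TERMS: the V-side type of the pin's index lines, the pullback hom, the pinned dictionary) + 2 data
constructors (`SplitLineE.ofCM` ∕ `ofCMOf`, the index line of record) + theorems;
0 records, nothing cited, 0 `def … : Prop`. Nothing here is a claim of the manuscripts under adjudication.
-/
import Summits.HodgeConjecture.HodgeCM.Model.Binders.JLiuK0Smooth
import Summits.HodgeConjecture.HodgeCM.Model.HsmallOfTowerAtLineTypeEq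
import Summits.HodgeConjecture.HodgeCM.Model.Binders.JLiuBlockTransport
import Summits.HodgeConjecture.HodgeCM.Model.ArchKTypeOfFin_2
import Summits.HodgeConjecture.HodgeCM.Model.WmInstanceV2

set_option autoImplicit false

/-!
# (J3) THE PIN'S V-SIDE CONSTANTS AT E — `SplitLineE V`, `ιVE V`, `liuDictionaryPin … I line`

axioms-1 #4r3 ∕ #6r2 leave the V-side of the index lines generic: `SplitLine JV TV hcδ hδ hd hV hVd hJV` with a pullback hom
`ιV : ↥V.adelicFin →* U(JV)(𝔸_f)` («intended: `JV := diagonal (frameD V)` with carch's frame transport `finFrameCongr`», #4r3 module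
docstring).  The HONEST side (sinst-1 #1246–#1253, binder-1 #R123–#R125, carch #CA61–#CA65) works throughout at the rational frame
OF RECORD `frameD V` (`Model/WmInstanceV2`, = `HermSpace3.rationalFrame_d V`) with the vendored CM splitting data
`cmSplittingDatum L e (frameD V) … dW …` — whose `splittingDatum` constants are `δ := imagUnit L`, `TV := realDiagonal L (frameD V) _`,
`hJV := (realDiagonal_map …).symm` (`Vendored/…/UnitaryDualPairThetaKernelCM.lean` :255–:267).  This leaf FIXES the pin's V-side constants
at E to exactly those, so that the theta lane's `line V : I V → SplitLineE V` and sinst-1's distribution data live over ONE `splittingDatum`: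

* `SplitLineE V` — `SplitLine (diagonal (frameD V)) (realDiagonal L (frameD V) _) (complexConj_imagUnit L) (imagUnit_ne_zero L)
  (imagUnit_mul_self L) (realDiagonal_isSymm …) (isUnit_det_realDiagonal … (frameD_ne V)) (realDiagonal_map …).symm` (reducible);
* `SplitLineE.ofCM V e dW hdW hdW0 s hs` ∕ `SplitLineE.ofCMOf … hGR` — THE INDEX LINE OF RECORD over a diagonal Gram scalar `dW : Fin 1 → L`
  (W-fields LITERALLY the `cmSplittingDatum` constants, theta-3-g28's typing remark l.14859; `ofCM_scalar : scalar = dW 0`, `ofCM_lineType`,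
  `continuous_pairSplitting_ofCMOf`) — the constructor theta-3's `Model/LiuIndexPin.lean` `line V` is to use;
* `ιVE V := finFrameCongr L V.Hm (frameG V) (frameD V) (frame_congr V)` (carch #ArchKTypeOfFin; continuous: `continuous_ιVE`);
* `liuDictionaryPin … V I line := liuDictionaryOfWeilFamilyAut … V (ιVE V) I line` — THE PINNED DICTIONARY modulo the theta lane's
  enumeration `(I V, line V)` (theta-3-g27 `I-ENUM-READ.g27.md`: `I ≃ {(s, [e], χ)}`, one Gram representative per line class);
* the binder-2 sockets and K0 obligations READ AT THE PIN: `hsmall_of_pin_at_of_isometric` ∕ `_of_lineType_eq` (#100),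
  `mem_biSup_block_pin_of_mem_iSup_range` (#101), `Ω_smooth_pin` (#99, `Continuous ιV` DISCHARGED by `continuous_finFrameCongr`),
  `isLevelTrivial_of_irreducible_pin` (#99), `line_injective_of_muSeparated_pin` ∕ `nontrivial_Ω_of_irreducible_pin` (#98).
Nothing is asserted about any instance; `I`, `line`, `hcite`, the slot clause and the `hfam` block clause remain hypotheses.
-/

noncomputable section

open Function Set
open NumberField
open scoped Matrix
open Literature.AlgebraicGeometry.Motives
open Literature.AlgebraicGeometry.ShimuraVarieties
open Literature.AlgebraicGeometry.HodgeTheory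
open Literature.NumberTheory.Automorphic
open Literature.NumberTheory.Automorphic.PicardCM
open Literature.NumberTheory.Weil1964
open Literature.NumberTheory.GelbartRogawski1991 Literature.NumberTheory.GelbartRogawski1991.UnitaryDualPair
open Literature.NumberTheory.Transcendental (Arapura2012_Cor_15_4_6)

namespace HodgeCM.Model

open HodgeCM.Model.TowerLevel HodgeCM.Model.TowerCarrier HodgeCM.Literature.Theta HodgeCM.Literature.Theta.LiuAlbaneseModuleDatum
open HodgeCM.CMTypeOps (inflate)
open HodgeCM.Universe (ThetaModel)
open HodgeCM.SignRecipe (lineType)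

variable {L : CMField} {ι₁ : (L : Type) →+* ℂ}

/-! ## §1. The V-side constants of record -/

/-- **the type of the pin's INDEX LINES at `V`**: split lines over the rational frame OF RECORD `diagonal (frameD V)` with the vendored
CM constants `δ := imagUnit L`, `TV := realDiagonal L (frameD V)` (the `splittingDatum` underlying `cmSplittingDatum L e (frameD V) … dW …`).
[folklore] -/
abbrev SplitLineE (V : HermSpace3 L ι₁) : Type :=
  SplitLine (Matrix.diagonal (frameD V)) (realDiagonal (L : Type) (frameD V) (frameD_real V))
    (complexConj_imagUnit (L : Type)) (imagUnit_ne_zero (L : Type)) (imagUnit_mul_self (L : Type))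
    (realDiagonal_isSymm (L : Type) (frameD V) (frameD_real V))
    (isUnit_det_realDiagonal (L : Type) (frameD V) (frameD_real V) (frameD_ne V))
    (realDiagonal_map (L : Type) (frameD V) (frameD_real V)).symm

/-- **the pullback hom of record** `U(V.Hm)(𝔸_f) →* U(diagonal (frameD V))(𝔸_f)`: carch's frame transport along `frameG V`. [folklore] -/
abbrev ιVE (V : HermSpace3 L ι₁) :
    ↥V.adelicFin →* ↥(UnitaryGroup.finAdelic (↥(maximalRealSubfield (L : Type))) (L : Type) (IsCMField.complexConj (L : Type)) 3
      (Matrix.diagonal (frameD V))) :=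
  finFrameCongr (L : Type) V.Hm (frameG V) (frameD V) (frame_congr V)

/-- the pullback hom of record is continuous. [folklore] -/
theorem continuous_ιVE (V : HermSpace3 L ι₁) : Continuous (ιVE V) :=
  continuous_finFrameCongr (L : Type) V.Hm (frameG V) (frameD V) (frame_congr V)

namespace SplitLineE

variable (V : HermSpace3 L ι₁) {n : ℕ} (e : Fin 3 × Fin 1 ≃ Fin n)
  (dW : Fin 1 → (L : Type)) (hdW : ∀ i, IsCMField.complexConj (L : Type) (dW i) = dW i) (hdW0 : ∀ i, dW i ≠ 0)
  (s : UnitaryGroup.adelicPair (↥(maximalRealSubfield (L : Type))) (L : Type) (IsCMField.complexConj (L : Type)) 3 1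
        (Matrix.diagonal (frameD V)) (Matrix.diagonal dW) →*
      adelicMpCont (↥(maximalRealSubfield (L : Type))) (Fin n)
        (adelicGram (↥(maximalRealSubfield (L : Type))) e (realDiagonal (L : Type) (frameD V) (frameD_real V))
          (realDiagonal (L : Type) dW hdW)))
  (hs : (cmSplittingDatum (L : Type) e (frameD V) (frameD_real V) (frameD_ne V) dW hdW hdW0).IsCompatible s)

/-- **THE INDEX LINE OF RECORD over a diagonal Gram scalar `dW : Fin 1 → L`** with a compatible pair splitting `s` of the CM datum
`cmSplittingDatum L e (frameD V) … dW …` (theta-3-g28's typing remark, STATUS l.14859): the `W`-fields are LITERALLY the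
`cmSplittingDatum` constants (`JW := diagonal dW`, `TW := realDiagonal L dW _`, `hJW := (realDiagonal_map …).symm`), so that `p.hs`'s
`splittingDatum` IS `cmSplittingDatum L e (frameD V) (frameD_real V) (frameD_ne V) dW hdW hdW0` (`cmSplittingDatum_eq`, `rfl`) and the
coinvariant side (#S14 `weilCoinv … p.hs`), the sockets #99–#102 and the distribution side (sinst-1 ∕ binder-1 over `cmSplittingDatum`)
elaborate against ONE term.  Reducible, so that the projections `.e ∕ .JW ∕ .s` compute. [folklore] -/
abbrev ofCM : SplitLineE V where
  n := n
  e := e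
  JW := Matrix.diagonal dW
  TW := realDiagonal (L : Type) dW hdW
  hW := realDiagonal_isSymm (L : Type) dW hdW
  hWd := isUnit_det_realDiagonal (L : Type) dW hdW hdW0
  hJW := (realDiagonal_map (L : Type) dW hdW).symm
  s := s
  hs := hs

/-- the Gram scalar of the index line of record is `dW 0`. [folklore] -/
@[simp] theorem ofCM_scalar : (ofCM V e dW hdW hdW0 s hs).scalar = dW 0 := by
  change Matrix.diagonal dW 0 0 = dW 0
  rw [Matrix.diagonal_apply_eq]

/-- its line type is `Φ^δ(dW 0)`. [folklore] -/
theorem ofCM_lineType : (ofCM V e dW hdW hdW0 s hs).lineType = SignRecipe.lineType (dW 0) (hdW 0) (hdW0 0) :=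
  SignRecipe.lineType_congr (ofCM_scalar V e dW hdW hdW0 s hs) _ _ _ _

/-- **the index line of record at the [GR91, Prop. 3.1.1] splitting** `splittingOf hGR` of the CM datum. [folklore] -/
abbrev ofCMOf (hGR : (cmSplittingDatum (L : Type) e (frameD V) (frameD_real V) (frameD_ne V) dW hdW hdW0).CompatibleSplitting) :
    SplitLineE V :=
  ofCM V e dW hdW hdW0
    (splittingOf (↥(maximalRealSubfield (L : Type))) (L : Type) (IsCMField.complexConj (L : Type)) 3 1 e
      (Matrix.diagonal (frameD V)) (Matrix.diagonal dW) (complexConj_imagUnit (L : Type)) (imagUnit_ne_zero (L : Type))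
      (imagUnit_mul_self (L : Type)) (realDiagonal_isSymm (L : Type) (frameD V) (frameD_real V))
      (realDiagonal_isSymm (L : Type) dW hdW) (isUnit_det_realDiagonal (L : Type) (frameD V) (frameD_real V) (frameD_ne V))
      (isUnit_det_realDiagonal (L : Type) dW hdW hdW0) (realDiagonal_map (L : Type) (frameD V) (frameD_real V)).symm
      (realDiagonal_map (L : Type) dW hdW).symm hGR)
    (splittingOf_isCompatible _ _ _ _ _ _ _ _ _ _ _ _ _ _ _ _ _ hGR)

/-- (Ported verbatim from the HodgeCMPerL package; no docstring in the source.) -/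
@[simp] theorem ofCMOf_scalar
    (hGR : (cmSplittingDatum (L : Type) e (frameD V) (frameD_real V) (frameD_ne V) dW hdW hdW0).CompatibleSplitting) :
    (ofCMOf V e dW hdW hdW0 hGR).scalar = dW 0 :=
  ofCM_scalar V e dW hdW hdW0 _ _

/-- the pair splitting of the index line of record at the GR91 splitting is CONTINUOUS (so #99's smoothness ∕ (R2) ∕ RIDER 1 apply to it
unconditionally). [folklore] -/
theorem continuous_pairSplitting_ofCMOf
    (hGR : (cmSplittingDatum (L : Type) e (frameD V) (frameD_real V) (frameD_ne V) dW hdW hdW0).CompatibleSplitting) :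
    Continuous (pairSplitting (↥(maximalRealSubfield (L : Type))) (L : Type) (IsCMField.complexConj (L : Type)) 3 1
      (ofCMOf V e dW hdW hdW0 hGR).e (Matrix.diagonal (frameD V)) (ofCMOf V e dW hdW hdW0 hGR).JW (ofCMOf V e dW hdW hdW0 hGR).s) :=
  continuous_pairSplitting_splittingOf _ _ _ _ _ _ _ _ _ _ _ _ _ _ _ _ _ hGR

end SplitLineE

/-- the slot clause of the pinned socket by EQUALITY of scalars: `b = a ⇒ ∃ z ≠ 0, b = z z̄ · a` (`z := 1`; e.g. sinst-1's `splitLineZero ∕ One`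
have scalar `lineVec L (dW c.D k) 0 = c.D.a k` on the nose). [folklore] -/
theorem exists_isometric_of_scalar_eq {a b : (L : Type)} (h : b = a) :
    ∃ z : (L : Type), z ≠ 0 ∧ b = z * conjRingHomK L z * a :=
  ⟨1, one_ne_zero, by rw [map_one, one_mul, one_mul, h]⟩


variable (hHD : exists_isReal_hodgeModel) (hI : hodgePQ_independent_of_hodgeModel)
  (h₁ : BallQuotientUniformised) (h₃ : CMAbelianVarietyRealised) (hA : Arapura2012_Cor_15_4_6)
variable (V : HermSpace3 L ι₁) (I : Type) (line : I → SplitLineE V)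

/-- **THE PINNED DICTIONARY at `V`** modulo the theta lane's enumeration `(I, line)`: axioms-1's indexed instance with the
`GoodChar` of record (`IsAutChar`) over the V-side constants of record and the pullback hom `ιVE V`. [folklore] -/
abbrev liuDictionaryPin : LiuDictionary hHD hI h₁ h₃ V :=
  liuDictionaryOfWeilFamilyAut hHD hI h₁ h₃ hA V (ιVE V) I line

/-- (Ported verbatim from the HodgeCMPerL package; no docstring in the source.) -/
theorem liuDictionaryPin_eq :
    liuDictionaryPin hHD hI h₁ h₃ hA V I line = liuDictionaryOfWeilFamilyAut hHD hI h₁ h₃ hA V (ιVE V) I line := rfl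

/-! ## §2. The sockets read at the pin -/

/-- **E's `hsmall` at `(V, c, i)` FROM THE PINNED DICTIONARY, slot clause by ISOMETRY** (#100 `hsmall_of_weilFamilyAut_at_of_isometric`
at the constants of record). [folklore] -/
theorem hsmall_of_pin_at_of_isometric (hR : DeligneMilne1982_Thm_6_20_full)
    (R : (picardCMUniverse hHD hI h₁ h₃).ThetaModel) (c : SeesawCtx L)
    (hcite : (liuDictionaryPin hHD hI h₁ h₃ hA V I line).Irreducible ∧ (liuDictionaryPin hHD hI h₁ h₃ hA V I line).Prop413 ∧
      (liuDictionaryPin hHD hI h₁ h₃ hA V I line).Thm418_2 ∧ (liuDictionaryPin hHD hI h₁ h₃ hA V I line).MuSeparated ∧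
      (liuDictionaryPin hHD hI h₁ h₃ hA V I line).Thm418C)
    (hgood : R.GoodCtx ι₁ c) (hrec : SignRecipe.GoodCtx (Model.orientBitι L ι₁) ι₁ c)
    (h6 : Module.finrank ℚ c.K = 6 ∧ IsNormalClosure ℚ c.K L ∧ (Module.finrank ℚ L = 24 ∨ Module.finrank ℚ L = 48))
    (i : Fin 4)
    (hJS : ∃ S : Finset I,
        (∀ j ∈ S, ∃ z : (L : Type), z ≠ 0 ∧ (line j).scalar = z * conjRingHomK L z * c.D.a i) ∧
        ∀ (Γ : Level V) (hΓ : Γ.BelowConjThree), ∀ ω ∈ R.Theta V c i Γ,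
          ∃ cf : towerLevel hHD hI (ballQuotientUniformisedDatum_of h₁) h₃ hA Γ hΓ,
            TowerLevel.res hHD hI (ballQuotientUniformisedDatum_of h₁) h₃ hA cf = ω ∧
              (ofLevel hHD hI (ballQuotientUniformisedDatum_of h₁) h₃ hA Γ hΓ cf :
                  (liuDictionaryPin hHD hI h₁ h₃ hA V I line).H) ∈
                ⨆ j ∈ S, (liuDictionaryPin hHD hI h₁ h₃ hA V I line).block j) :
    ∃ Γ₀ : Level V, ∀ Γ ≤ Γ₀,
      ∃ (M : CMField) (k : c.K →+* M) (σ' : M →+* ℂ), σ'.comp k = c.σ ∧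
        R.Theta V c i Γ ⊆ (picardCMUniverse hHD hI h₁ h₃).Uiso Γ M (inflate k (c.Ψ i)) σ' :=
  hsmall_of_weilFamilyAut_at_of_isometric hHD hI h₁ h₃ hA V (ιVE V) I line hR R c hcite hgood hrec h6 i hJS

/-- the same with the slot clause as a TYPE EQUATION `(line j).lineType = Φ^δ(a_i)` (#100). [folklore] -/
theorem hsmall_of_pin_at_of_lineType_eq (hR : DeligneMilne1982_Thm_6_20_full)
    (R : (picardCMUniverse hHD hI h₁ h₃).ThetaModel) (c : SeesawCtx L)
    (hcite : (liuDictionaryPin hHD hI h₁ h₃ hA V I line).Irreducible ∧ (liuDictionaryPin hHD hI h₁ h₃ hA V I line).Prop413 ∧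
      (liuDictionaryPin hHD hI h₁ h₃ hA V I line).Thm418_2 ∧ (liuDictionaryPin hHD hI h₁ h₃ hA V I line).MuSeparated ∧
      (liuDictionaryPin hHD hI h₁ h₃ hA V I line).Thm418C)
    (hgood : R.GoodCtx ι₁ c) (hrec : SignRecipe.GoodCtx (Model.orientBitι L ι₁) ι₁ c)
    (h6 : Module.finrank ℚ c.K = 6 ∧ IsNormalClosure ℚ c.K L ∧ (Module.finrank ℚ L = 24 ∨ Module.finrank ℚ L = 48))
    (i : Fin 4)
    (hJS : ∃ S : Finset I,
        (∀ j ∈ S, (line j).lineType = lineType (c.D.a i) (c.D.a_real i) (c.D.a_ne i)) ∧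
        ∀ (Γ : Level V) (hΓ : Γ.BelowConjThree), ∀ ω ∈ R.Theta V c i Γ,
          ∃ cf : towerLevel hHD hI (ballQuotientUniformisedDatum_of h₁) h₃ hA Γ hΓ,
            TowerLevel.res hHD hI (ballQuotientUniformisedDatum_of h₁) h₃ hA cf = ω ∧
              (ofLevel hHD hI (ballQuotientUniformisedDatum_of h₁) h₃ hA Γ hΓ cf :
                  (liuDictionaryPin hHD hI h₁ h₃ hA V I line).H) ∈
                ⨆ j ∈ S, (liuDictionaryPin hHD hI h₁ h₃ hA V I line).block j) :
    ∃ Γ₀ : Level V, ∀ Γ ≤ Γ₀,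
      ∃ (M : CMField) (k : c.K →+* M) (σ' : M →+* ℂ), σ'.comp k = c.σ ∧
        R.Theta V c i Γ ⊆ (picardCMUniverse hHD hI h₁ h₃).Uiso Γ M (inflate k (c.Ψ i)) σ' :=
  hsmall_of_weilFamilyAut_at_of_lineType_eq hHD hI h₁ h₃ hA V (ιVE V) I line hR R c hcite hgood hrec h6 i hJS

/-- **the `hJS` block clause at the pin from the theta side's own model** (#101 at the constants of record): a tower vector in the
isotypic sum of a `ℂ[U(V)(𝔸_f)]`-quotient `M` of `Ω(line j, χ)`, `j ∈ S`, `χ` automorphic, lies in `⨆ j ∈ S, block j`. [folklore] -/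
theorem mem_biSup_block_pin_of_mem_iSup_range {M : Type*} [AddCommGroup M] [Module (adelicAlgebra V) M]
    {S : Finset I} {j : I} (hj : j ∈ S) {χ : (line j).CharW} (hχ : (line j).IsAutChar χ)
    (φ : (line j).Ω (ιVE V) χ →ₗ[adelicAlgebra V] M) (hφ : Surjective φ)
    {x : Tower hHD hI (ballQuotientUniformisedDatum_of h₁) h₃ hA V}
    (hx : x ∈ ⨆ ψ : M →ₗ[adelicAlgebra V] Tower hHD hI (ballQuotientUniformisedDatum_of h₁) h₃ hA V,
      (LinearMap.range ψ).restrictScalars ℂ) :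
    (x : (liuDictionaryPin hHD hI h₁ h₃ hA V I line).H) ∈ ⨆ j ∈ S, (liuDictionaryPin hHD hI h₁ h₃ hA V I line).block j :=
  mem_biSup_block_weilFamilyAut_of_mem_iSup_range hHD hI h₁ h₃ hA V (ιVE V) I line hj hχ φ hφ hx

/-! ## §3. The K0 obligations read at the pin -/

/-- **`Ω(line i, χ)` is a SMOOTH `ℂ[U(V)(𝔸_f)]`-module at the pin** for every index line with continuous pair splitting (#99 `Ω_smooth`
with `Continuous ιV` discharged by `continuous_finFrameCongr`). [folklore] -/
theorem Ω_smooth_pin (i : I)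
    (hsc : Continuous (pairSplitting (↥(maximalRealSubfield (L : Type))) (L : Type) (IsCMField.complexConj (L : Type)) 3 1
      (line i).e (Matrix.diagonal (frameD V)) (line i).JW (line i).s))
    (χ : (line i).CharW) (x : (line i).Ω (ιVE V) χ) :
    ∃ K : Subgroup ↥V.adelicFin, IsOpen (K : Set ↥V.adelicFin) ∧ ∀ g ∈ K, (MonoidAlgebra.of ℂ ↥V.adelicFin g) • x = x :=
  (line i).Ω_smooth (ιVE V) hsc (continuous_ιVE V) χ x

/-- **K0 RIDER 1 at the pin**: at an index line with continuous pair splitting, the cited `Irreducible` of the pinned dictionary FORCES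
every automorphic-cut character to be level-trivial (#99; tautological for `IsAutChar`, recorded as the obligation any weaker cut would
have to meet). [folklore] -/
theorem isLevelTrivial_of_irreducible_pin (h : (liuDictionaryPin hHD hI h₁ h₃ hA V I line).Irreducible) (i : I)
    (hsc : Continuous (pairSplitting (↥(maximalRealSubfield (L : Type))) (L : Type) (IsCMField.complexConj (L : Type)) 3 1
      (line i).e (Matrix.diagonal (frameD V)) (line i).JW (line i).s))
    {χ : (line i).CharW} (hχ : (line i).IsAutChar χ) : (line i).IsLevelTrivial χ :=
  isLevelTrivial_of_irreducible_of_continuous hHD hI h₁ h₃ hA V (ιVE V) I line (fun i χ => (line i).IsAutChar χ) h i hsc hχ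

/-- **`Ω ≠ 0` at the pin**: the cited `Irreducible` FORCES `Ω(line i, χ) ≠ 0` for every automorphic `χ` (#98). [folklore] -/
theorem nontrivial_Ω_of_irreducible_pin (h : (liuDictionaryPin hHD hI h₁ h₃ hA V I line).Irreducible) (i : I)
    {χ : (line i).CharW} (hχ : (line i).IsAutChar χ) : Nontrivial ((line i).Ω (ιVE V) χ) :=
  nontrivial_Ω_of_irreducible hHD hI h₁ h₃ hA V (ιVE V) I line (fun i χ => (line i).IsAutChar χ) h i hχ

/-- **K0 RIDER 2 at the pin**: the cited `MuSeparated` FORCES `line` INJECTIVE (#98). [folklore] -/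
theorem line_injective_of_muSeparated_pin (hμ : (liuDictionaryPin hHD hI h₁ h₃ hA V I line).MuSeparated) :
    Function.Injective line :=
  line_injective_of_muSeparated_aut hHD hI h₁ h₃ hA V (ιVE V) I line hμ

end HodgeCM.Model

end
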